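import Summits.AtomisticToContinuum.Crystallization.Theorems.PalmUnimodularRigidityLayeredLawsSelectHcpChartStarFrame
import Summits.AtomisticToContinuum.Crystallization.Theorems.ReggeStarCoercivityDefectFreeCrystallizesGoodOfSmallStarDefect
import Summits.AtomisticToContinuum.Crystallization.Theorems.ReggeStarCoercivityDefectFreeCrystallizesGoodOfSmallFccDefect
import Literature.Probability.Process.PointStationaryLaw
import Literature.Geometry.DiscreteGeometry.KissingPatterns
import HarnessLib

/-!
# No small fcc-star defect at the root of an hcp-charted configuration (stub `stub_noFccStarInHcpChart`,
# merge lemma of line `palm-good-law`, crux `ReggeStarCoercivity.DefectFreeCrystallizes`,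
# stmt-AtomisticToContinuum-13603)

**Theorem** (`stub_noFccStarInHcpChart`).  Let `a₀ ∈ [189/200, 199/200]`, let `S ⊆ ℝ³` contain the root `0`,
let the root be `GoodShell` (the `1 %` tube of crux 9226) and let `S` be hcp-charted (`HcpCharted`).  Then the
fcc-star defect of the root star `rootStar (count|S) = {y : count|S {y} ≠ 0, 0 < ‖y‖ ≤ 11/10}` against the
regular cuboctahedron `a₀ • fccKissingPattern` is NOT small:
`1/20000 ≤ ⨅_A ∑_{p ∈ fccKissingPattern} infDist (A (a₀ • p)) (rootStar (count|S))²`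
(`A` over the linear isometries of `ℝ³`).  This is the exclusion of the fcc branch in the merge of the
law-level floor of line `palm-good-law` with the rigidity statement of crux 9226.

**Proof** (contrapositive; finite geometry and one graph invariant).
* The good shell of the root (scale `a ∈ [9/10, 1]`) is a twelve-point `Finset` `T = {y ∈ S : y ≠ 0, ‖y‖ ≤ 5a/4}`
  matched within `a/100` to a rotated scaled kissing pattern, so its atoms have norm `≤ 101a/100 ≤ 11/10`;
  hence `rootStar (count|S) = T` (`count_restrict_singleton_ne_zero_iff`), in particular the root star is
  non-empty.
* A rooted labelled chart `X` (`tube_exists_rootedChart`) puts its twelve star atoms `X v`, `v ∈ hcpStarIdx`,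
  at bond distance `≤ 28/25 ≤ 5a/4` from the root, i.e. in `T`.
* If the defect were `< 1/20000`, an almost optimal isometry `A` (`exists_lt_of_ciInf_lt`) would put every point
  of `A (a₀ • fccKissingPattern)` within `√(1/20000) < a₀/100` of an atom of `T` (`Metric.infDist_lt_iff`); the
  pattern images are `≥ a₀ > 2 · a₀/100` apart (`GoodOfSmallFccDefect.le_dist_of_mem_image`), so nearest atoms
  give an `(a₀/100)`-matching of `T` with the rotated scaled cuboctahedron (`GoodOfSmallStarDefect.etaMatched_of_near`).
* Aligned with the chart, the matching is a contact-graph isomorphism of the labelled hcp star into the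
  cuboctahedron (`matched_labels`, pattern distances are `1` or `≥ √2`, `fcc_dist_eq_one`).  But the edge
  `{(0,1,0), (0,0,1)}` of the hcp star lies in the two triangles through `(±1,0,0)` (`ideal_edge_two_triangles`),
  while in the cuboctahedron every edge lies in exactly one triangle (`fcc_edge_one_triangle`) — contradiction.

All `[folklore]`.  Imports: only modules already imported by the line's skeleton.
-/

noncomputable section

open scoped BigOperators ENNReal
open MeasureTheory

namespace Summit.AtomisticToContinuum.Crystallization.Theorems.PalmGoodLaw.NoFccStarInHcpChart

open Literature.MathematicalPhysics.StatisticalMechanics Literature.Geometry.DiscreteGeometry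
open Literature.Probability.Process
open Summit.AtomisticToContinuum.Crystallization.Theorems.PalmUnimodularRigidity.LayeredLawsSelectHcp
open Summit.AtomisticToContinuum.Crystallization.Theorems.LayeredLawsSelectHcp.Negative.DiracLaws (GoodShell)
open Summit.AtomisticToContinuum.Crystallization.Theorems.PalmGoodLaw.GoodOfSmallStarDefect (etaMatched_of_near)
open Summit.AtomisticToContinuum.Crystallization.Theorems.PalmGoodLaw.GoodOfSmallFccDefect (le_dist_of_mem_image)

/-- The atoms of a shell `(η)`-close to a scaled pattern of unit vectors `a • P` (`a ≥ 0`) have norm `≤ a + η`.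
[folklore] -/
theorem norm_le_of_shellCloseTo {η a : ℝ} (ha : 0 ≤ a) {T P : Finset (EuclideanSpace ℝ (Fin 3))}
    (hP : ∀ p ∈ P, ‖p‖ = 1)
    (h : ShellCloseTo η T (Finset.image (fun v : EuclideanSpace ℝ (Fin 3) => a • v) P)) :
    ∀ t ∈ T, ‖t‖ ≤ a + η := by
  intro t ht
  obtain ⟨A, e, he⟩ := h
  have hd := he ⟨t, ht⟩
  obtain ⟨q, hq, hq'⟩ := Finset.mem_image.1 (e ⟨t, ht⟩).2
  obtain ⟨p, hp, rfl⟩ := Finset.mem_image.1 hq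
  have hn : ‖((e ⟨t, ht⟩ : ↥(Finset.image A (Finset.image (fun v => a • v) P))) : EuclideanSpace ℝ (Fin 3))‖ = a := by
    rw [← hq', LinearIsometry.norm_map, norm_smul, Real.norm_of_nonneg ha, hP p hp, mul_one]
  have htri := norm_sub_norm_le (t : EuclideanSpace ℝ (Fin 3))
    ((e ⟨t, ht⟩ : ↥(Finset.image A (Finset.image (fun v => a • v) P))) : EuclideanSpace ℝ (Fin 3))
  rw [← dist_eq_norm, hn] at htri
  linarith

/-- **stub_noFccStarInHcpChart** (merge lemma of line `palm-good-law`): in an hcp-CHARTED configuration with a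
`GoodShell` root, the fcc-star defect of the root star against `a₀ • fccKissingPattern`, `a₀ ∈ [189/200, 199/200]`,
is `≥ 1/20000`.  Otherwise nearest atoms match the twelve-point shell of the root (`= rootStar`, which contains the
chart's twelve star atoms) with a rotated scaled cuboctahedron within `a₀/100`; aligned with the chart this is a
contact-graph isomorphism of the labelled hcp star into the cuboctahedron (`matched_labels`), impossible since the
hcp star has an edge in two triangles (`ideal_edge_two_triangles`) and the cuboctahedron has none
(`fcc_edge_one_triangle`). [folklore] -/
theorem stub_noFccStarInHcpChart :
    ∀ a₀ : ℝ, 189 / 200 ≤ a₀ → a₀ ≤ 199 / 200 → ∀ S : Set (EuclideanSpace ℝ (Fin 3)), (0 : EuclideanSpace ℝ (Fin 3)) ∈ S → Summit.AtomisticToContinuum.Crystallization.Theorems.LayeredLawsSelectHcp.Negative.DiracLaws.GoodShell S 0 → Summit.AtomisticToContinuum.Crystallization.Theorems.PalmUnimodularRigidity.LayeredLawsSelectHcp.HcpCharted S → (1 / 20000 : ℝ) ≤ ⨅ A : EuclideanSpace ℝ (Fin 3) ≃ₗᵢ[ℝ] EuclideanSpace ℝ (Fin 3), ∑ p ∈ fccKissingPattern,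 Metric.infDist (A (a₀ • p)) (Summit.AtomisticToContinuum.Crystallization.Theorems.PalmUnimodularRigidity.LayeredLawsSelectHcp.rootStar ((MeasureTheory.Measure.count : MeasureTheory.Measure (EuclideanSpace ℝ (Fin 3))).restrict S)) ^ 2 := by
  intro a₀ ha₁ ha₂ S h0S hgood hchart
  by_contra hlt
  rw [not_le] at hlt
  -- (1) the good shell of the root: twelve atoms of norm `≤ 101a/100`
  obtain ⟨a, h9, h1, T, hT, hclose⟩ := hgood
  have hmemT : ∀ y : EuclideanSpace ℝ (Fin 3), y ∈ T ↔ y ∈ S ∧ y ≠ 0 ∧ ‖y‖ ≤ 5 / 4 * a := by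
    intro y
    rw [← Finset.mem_coe, hT]
    simp only [sub_zero, Set.image_id', Set.mem_setOf_eq, dist_zero_right]
  have ha : a ≠ 0 := ne_of_gt (by linarith)
  have hTcard : T.card = 12 := by
    rcases hclose with h | h
    · rw [h.card_eq, Finset.card_image_of_injective _ (smul_right_injective _ ha), card_fccKissingPattern]
    · rw [h.card_eq, Finset.card_image_of_injective _ (smul_right_injective _ ha), card_hcpKissingPattern]
  have hTnorm : ∀ t ∈ T, ‖t‖ ≤ a + a / 100 := by
    rcases hclose with h | h
    · exact norm_le_of_shellCloseTo (by linarith) (fun p hp => norm_eq_one_of_mem_fccKissingPattern hp) h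
    · exact norm_le_of_shellCloseTo (by linarith) (fun p hp => norm_eq_one_of_mem_hcpKissingPattern hp) h
  -- (2) the root star is the shell
  have hroot : rootStar ((Measure.count : Measure (EuclideanSpace ℝ (Fin 3))).restrict S) = ↑T := by
    ext y
    rw [Finset.mem_coe, hmemT y]
    change (Measure.count : Measure (EuclideanSpace ℝ (Fin 3))).restrict S {y} ≠ 0 ∧ 0 < ‖y‖ ∧ ‖y‖ ≤ 11 / 10 ↔ _
    rw [count_restrict_singleton_ne_zero_iff S y, norm_pos_iff]
    constructor
    · rintro ⟨hyS, hy0, hy1⟩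
      exact ⟨hyS, hy0, by linarith⟩
    · rintro ⟨hyS, hy0, hy1⟩
      exact ⟨hyS, hy0, by linarith [hTnorm y ((hmemT y).2 ⟨hyS, hy0, hy1⟩)]⟩
  have hTne : (↑T : Set (EuclideanSpace ℝ (Fin 3))).Nonempty :=
    Finset.coe_nonempty.2 (Finset.card_pos.1 (by rw [hTcard]; norm_num))
  -- (3) a rooted labelled chart; its twelve star atoms lie in the shell
  obtain ⟨X, hX0, hXS, -, hch⟩ := tube_exists_rootedChart S h0S hchart
  have hXT : ∀ v ∈ hcpStarIdx, X v ∈ T := by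
    intro v hv
    have hd1 : dist (hcpSite 1 (Real.sqrt (2 / 3)) 0) (hcpSite 1 (Real.sqrt (2 / 3)) v) = 1 :=
      (dist_ideal_eq_one_iff_nbr 0 v).2 ⟨v, hv, (RootedChartUnique.nbr_zero v).symm⟩
    obtain ⟨hpos, hle⟩ := (hch 0 v).1 hd1
    rw [hX0, dist_comm, dist_zero_right] at hpos hle
    exact (hmemT _).2 ⟨hXS v, norm_pos_iff.1 hpos, by linarith⟩
  -- (4) an almost optimal isometry: every rotated scaled fcc point is within `a₀/100` of a shell atom
  obtain ⟨A, hA⟩ := exists_lt_of_ciInf_lt hlt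
  rw [hroot] at hA
  have ha0 : 0 ≤ a₀ := by linarith
  set P' : Finset (EuclideanSpace ℝ (Fin 3)) :=
    (Finset.image (fun v : EuclideanSpace ℝ (Fin 3) => a₀ • v) fccKissingPattern).image A.toLinearIsometry
    with hP'_def
  have hmemP' : ∀ q : EuclideanSpace ℝ (Fin 3), q ∈ P' ↔ ∃ p ∈ fccKissingPattern, A (a₀ • p) = q := by
    intro q
    simp only [hP'_def, Finset.mem_image, LinearIsometryEquiv.coe_toLinearIsometry, exists_exists_and_eq_and]
  have hnear : ∀ q ∈ P', ∃ t ∈ T, dist t q ≤ a₀ / 100 := by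
    intro q hq
    obtain ⟨p, hp, rfl⟩ := (hmemP' q).1 hq
    have hterm : Metric.infDist (A (a₀ • p)) (↑T : Set (EuclideanSpace ℝ (Fin 3))) ^ 2 < 1 / 20000 :=
      lt_of_le_of_lt
        (Finset.single_le_sum
          (f := fun p => Metric.infDist (A (a₀ • p)) (↑T : Set (EuclideanSpace ℝ (Fin 3))) ^ 2)
          (fun q _ => sq_nonneg _) hp) hA
    have hsq : Metric.infDist (A (a₀ • p)) (↑T : Set (EuclideanSpace ℝ (Fin 3))) ^ 2 < (a₀ / 100) ^ 2 :=
      hterm.trans_le (by nlinarith)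
    have hlt' : Metric.infDist (A (a₀ • p)) (↑T : Set (EuclideanSpace ℝ (Fin 3))) < a₀ / 100 :=
      lt_of_pow_lt_pow_left₀ 2 (by positivity) hsq
    obtain ⟨y, hy, hd⟩ := (Metric.infDist_lt_iff hTne).1 hlt'
    exact ⟨y, Finset.mem_coe.1 hy, by rw [dist_comm]; exact hd.le⟩
  -- pattern images are `≥ a₀ > 2 · a₀/100` apart, and there are twelve of them
  have hsep : ∀ q ∈ P', ∀ q' ∈ P', q ≠ q' → 2 * (a₀ / 100) < dist q q' := by
    intro q hq q' hq' hqq'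
    obtain ⟨p, hp, rfl⟩ := (hmemP' q).1 hq
    obtain ⟨p', hp', rfl⟩ := (hmemP' q').1 hq'
    have := le_dist_of_mem_image ha0 A hp hp' hqq'
    linarith
  have hP'card : P'.card = 12 := by
    rw [hP'_def, Finset.card_image_of_injective _ A.toLinearIsometry.injective,
      Finset.card_image_of_injective _
        (smul_right_injective (EuclideanSpace ℝ (Fin 3)) (ne_of_gt (by linarith) : a₀ ≠ 0)),
      card_fccKissingPattern]
  -- (5) nearest atoms match the shell with the rotated scaled cuboctahedron within `a₀/100`
  have he : EtaMatched (a₀ / 100) T P' := etaMatched_of_near (hTcard.trans hP'card.symm) hsep hnear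
  -- (6) aligned with the chart: a contact-graph isomorphism of the hcp star into the cuboctahedron — impossible
  obtain ⟨φ, hφP, -, hinj, hadj⟩ :=
    matched_labels (P := fccKissingPattern) hch (by linarith) (by linarith) hXT fcc_dist_eq_one he
  have m0 : ((0, 1, 0) : ℤ × ℤ × ℤ) ∈ hcpStarIdx := by decide
  have m1 : ((0, 0, 1) : ℤ × ℤ × ℤ) ∈ hcpStarIdx := by decide
  have m2 : ((1, 0, 0) : ℤ × ℤ × ℤ) ∈ hcpStarIdx := by decide
  have m3 : ((-1, 0, 0) : ℤ × ℤ × ℤ) ∈ hcpStarIdx := by decide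
  obtain ⟨d01, d02, d12, d03, d13⟩ := ideal_edge_two_triangles
  have heq : φ (1, 0, 0) = φ (-1, 0, 0) :=
    fcc_edge_one_triangle (hφP _ m0) (hφP _ m1) (hφP _ m2) (hφP _ m3) ((hadj _ m0 _ m1).2 d01)
      ((hadj _ m0 _ m2).2 d02) ((hadj _ m1 _ m2).2 d12) ((hadj _ m0 _ m3).2 d03) ((hadj _ m1 _ m3).2 d13)
  exact absurd (hinj m2 m3 heq) (by decide)

end Summit.AtomisticToContinuum.Crystallization.Theorems.PalmGoodLaw.NoFccStarInHcpChart

end
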